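import Summits.CriticalPhenomena.PercolationContinuityZ3.Theorems.PercNearOneGluingNoHeavyLowerTailSahiCTCLadderThreeRowTwoPinned
import HarnessLib

/-!
# `NoHeavyLowerTail` (crux stmt-CriticalPhenomena-4575), P3 lane: the row `#dbl = 2` of `(L_3)` for `τ ≥ 9`

Support file (seat `prim-l12-p3`, gen 26; `--supports stmt-CriticalPhenomena-4575`).  Memo g26 §4.12–4.13.  The supply of the row
`#dbl m = 2` (`n = τ − 1`) has three valid linear lower bounds per cube family: the t-DENSITY split bounds of the dense regime
(`rowTwo_density_facts_R/_ML`) and the PINNED bounds (`rowTwo_pinned_facts_R/_M`).  The convex combination with weights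
`w₁ = (n²−7n−6)/(3n(n−1))` (split) and `(n²+2n+3)/(3n(n−1))` (each pinned orientation) on the restriction cubes, and
`μ = (2n³−8n²+3n+15)/(3n(n−1)²)` (split) / `1 − μ` (pinned) on the link cubes, equals the charge `cH(3,τ+1)·a + τ·(q₁+q₂) + ε`
IDENTICALLY (`rowTwo_arith`, integer form with common denominator `6n²(n−1)³`; `w₁ ≥ 0` needs `n ≥ 8`).  Hence
**`coeff_ladder_three_rowTwo_nonneg`**: ROW `#dbl = 2` OF `(L_3)` for `τ ≥ 9`, unconditionally.  Nothing is asserted about the crux.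
-/

namespace Summit.CriticalPhenomena.PercolationContinuityZ3.Theorems.SahiCTCForms

open Finset MvPolynomial SahiCTCGenFun SahiCTCWeightedLYM

variable {α : Type*} [DecidableEq α] [Fintype α]

section RowTwoAll
variable {𝒳 𝒵 : Finset (Finset α)}

omit [DecidableEq α] [Fintype α] in
/-- The integer certificate of the row `#dbl = 2` (`n = τ − 1 ≥ 8`): split bounds `f1–f6, hB, hMa, hMb`, pinned bounds
`pa3, pa2, pb3, pb2, hRa, hRb, ma, mb`, first normalised to one bound per cube family and method (`n(n−1)·R ≥ …`, `M ≥ …`), then combined with the multipliers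
`n²−7n−6` (split, restriction), `n²+2n+3` (each pinned orientation, restriction), `n(2n³−8n²+3n+15)` (split, link),
`n(n³+2n²−15)` (pinned, link), `n²(n−1)²` (double link) against `6n²(n−1)²` times the charge. [this work] -/
theorem rowTwo_arith {n a q₁ q₂ ε a' q₁' q₂' ε' Γ cH3 R M1 M2 L B₁ B2a B2b B₃ N₁ N₂ R1a R2a R1b R2b : ℤ} (hn : 8 ≤ n)
    (f1 : a ≤ B₁) (f2 : 2 * (n + 1) * (q₁ + q₂) ≤ n * (B2a + B2b)) (f3 : 6 * cH3 * ε ≤ n * (n - 1) * B₃)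
    (hB : B₃ + B2b + (B2a + B₁) ≤ R)
    (f4 : n * (q₁ + q₂) ≤ N₂) (f5 : a * n ≤ N₁) (hM : N₂ + N₁ ≤ M1 + M2) (f6 : a * n * (n - 1) ≤ 6 * L)
    (hRa : R1a + R2a ≤ R) (pa3 : 2 * (n - 1) * cH3 * q₁ + 6 * (n + 1) * ε ≤ n * (n - 1) * R1a)
    (pa2 : n * (n + 1) * a + 2 * q₂ ≤ n * R2a)
    (hRb : R1b + R2b ≤ R) (pb3 : 2 * (n - 1) * cH3 * q₂ + 6 * (n + 1) * ε ≤ n * (n - 1) * R1b)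
    (pb2 : n * (n + 1) * a + 2 * q₁ ≤ n * R2b)
    (ma : n ^ 2 * a + 2 * q₂ ≤ 2 * M1) (mb : n ^ 2 * a + 2 * q₁ ≤ 2 * M2)
    (ecH3 : 2 * cH3 = n ^ 2 + n + 2) (eΓ : 2 * Γ = (n + 2) ^ 2 + (n + 2) + 2)
    (ha : a' ≤ a) (hq₁ : q₁' ≤ q₁) (hq₂ : q₂' ≤ q₂) (hε : ε' ≤ ε) :
    Γ * a' + (n + 1) * (q₁' + q₂') + ε' ≤ R + M1 + M2 + L := by
  have hn0 : (0 : ℤ) ≤ n := by linarith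
  have hn1 : (0 : ℤ) ≤ n - 1 := by linarith
  have hΓ0 : 0 ≤ Γ := by nlinarith only [eΓ, sq_nonneg (n + 2), hn]
  have hmono : Γ * a' + (n + 1) * (q₁' + q₂') + ε' ≤ Γ * a + (n + 1) * (q₁ + q₂) + ε := by
    have m1 := mul_le_mul_of_nonneg_left ha hΓ0
    have m2 := mul_le_mul_of_nonneg_left (add_le_add hq₁ hq₂) (show (0 : ℤ) ≤ n + 1 by linarith)
    linarith only [m1, m2, hε]
  refine hmono.trans ?_
  -- stage 1: one normalised bound per cube family and method
  have hnn : (0 : ℤ) ≤ n * (n - 1) := mul_nonneg hn0 hn1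
  have S1 : n * (n - 1) * a + 2 * (n - 1) * (n + 1) * (q₁ + q₂) + 6 * cH3 * ε ≤ n * (n - 1) * R := by
    have g1 := mul_le_mul_of_nonneg_left f1 hnn
    have g2 := mul_le_mul_of_nonneg_left f2 hn1
    have gB := mul_le_mul_of_nonneg_left hB hnn
    linarith only [g1, g2, gB, f3]
  have S2 : 2 * (n - 1) * cH3 * q₁ + 6 * (n + 1) * ε + (n - 1) * (n * (n + 1) * a + 2 * q₂) ≤ n * (n - 1) * R := by
    have g2 := mul_le_mul_of_nonneg_left pa2 hn1
    have gR := mul_le_mul_of_nonneg_left hRa hnn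
    linarith only [pa3, g2, gR]
  have S3 : 2 * (n - 1) * cH3 * q₂ + 6 * (n + 1) * ε + (n - 1) * (n * (n + 1) * a + 2 * q₁) ≤ n * (n - 1) * R := by
    have g2 := mul_le_mul_of_nonneg_left pb2 hn1
    have gR := mul_le_mul_of_nonneg_left hRb hnn
    linarith only [pb3, g2, gR]
  have S4 : n * (q₁ + q₂) + a * n ≤ M1 + M2 := by linarith only [f4, f5, hM]
  have S5 : n ^ 2 * a + (q₁ + q₂) ≤ M1 + M2 := by linarith only [ma, mb]
  -- stage 2: the certificate (weights cleared of denominators by 6 n² (n−1)²)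
  have hn8 : (0 : ℤ) ≤ n - 8 := by linarith only [hn]
  have hw : (0 : ℤ) ≤ 2 * (n ^ 2 - 7 * n - 6) := by nlinarith only [mul_nonneg hn0 hn8, hn]
  have hv : (0 : ℤ) ≤ 2 * (n ^ 2 + 2 * n + 3) := by positivity
  have hn4 : (0 : ℤ) ≤ n - 4 := by linarith only [hn]
  have hu1 : (0 : ℤ) ≤ 2 * n ^ 3 - 8 * n ^ 2 + 3 * n + 15 := by nlinarith only [mul_nonneg (mul_nonneg hn0 hn0) hn4, hn]
  have hu2 : (0 : ℤ) ≤ n ^ 3 + 2 * n ^ 2 - 15 := by nlinarith only [mul_nonneg (mul_nonneg hn0 hn0) hn4, hn]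
  have hU1 : (0 : ℤ) ≤ 2 * n * (2 * n ^ 3 - 8 * n ^ 2 + 3 * n + 15) := mul_nonneg (by positivity) hu1
  have hU2 : (0 : ℤ) ≤ 2 * n * (n ^ 3 + 2 * n ^ 2 - 15) := mul_nonneg (by positivity) hu2
  have hUL : (0 : ℤ) ≤ n ^ 2 * (n - 1) ^ 2 := mul_nonneg (sq_nonneg _) (sq_nonneg _)
  have g1 := mul_le_mul_of_nonneg_left S1 hw
  have g2 := mul_le_mul_of_nonneg_left S2 hv
  have g3 := mul_le_mul_of_nonneg_left S3 hv
  have g4 := mul_le_mul_of_nonneg_left S4 hU1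
  have g5 := mul_le_mul_of_nonneg_left S5 hU2
  have g6 := mul_le_mul_of_nonneg_left f6 hUL
  -- products of the numeric constants with the counts, pre-multiplied by their weights
  have hΓa : 6 * n ^ 2 * (n - 1) ^ 2 * (Γ * a) = 3 * n ^ 2 * (n - 1) ^ 2 * ((n + 2) ^ 2 + (n + 2) + 2) * a := by
    linear_combination (3 * n ^ 2 * (n - 1) ^ 2 * a) * eΓ
  have hce : 2 * (n ^ 2 - 7 * n - 6) * (6 * cH3 * ε) = 6 * (n ^ 2 - 7 * n - 6) * (n ^ 2 + n + 2) * ε := by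
    linear_combination (6 * (n ^ 2 - 7 * n - 6) * ε) * ecH3
  have hc1 : 2 * (n ^ 2 + 2 * n + 3) * (2 * (n - 1) * cH3 * q₁) = 2 * (n ^ 2 + 2 * n + 3) * (n - 1) * (n ^ 2 + n + 2) * q₁ := by
    linear_combination (2 * (n ^ 2 + 2 * n + 3) * (n - 1) * q₁) * ecH3
  have hc2 : 2 * (n ^ 2 + 2 * n + 3) * (2 * (n - 1) * cH3 * q₂) = 2 * (n ^ 2 + 2 * n + 3) * (n - 1) * (n ^ 2 + n + 2) * q₂ := by
    linear_combination (2 * (n ^ 2 + 2 * n + 3) * (n - 1) * q₂) * ecH3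
  have hD : (0 : ℤ) < 6 * n ^ 2 * (n - 1) ^ 2 := by
    have : (0 : ℤ) < n - 1 := by linarith only [hn]
    positivity
  refine le_of_mul_le_mul_left ?_ hD
  linarith only [g1, g2, g3, g4, g5, g6, hΓa, hce, hc1, hc2]

/-- **ROW `#dbl = 2` OF `(L_3)`** (`τ ≥ 9`, unconditional): split bounds (t-DENSITY) and pinned bounds (PINNED t-density) of the
restriction and link cubes, combined by `rowTwo_arith`. [this work] -/
theorem coeff_ladder_three_rowTwo_nonneg (h𝒳 : IsUpperSet (𝒳 : Set (Finset α))) (h𝒵 : IsUpperSet (𝒵 : Set (Finset α)))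
    (hX3 : ∀ S ∈ 𝒳, 3 ≤ #S) (hZ3 : ∀ S ∈ 𝒵, 3 ≤ #S) {m : α →₀ ℕ} (hm : ∀ i, m i ≤ 2) (hD : #(dbl m) = 2) (hτ : 9 ≤ #(lev m 1)) :
    0 ≤ (ee 3 * (PiP * gf (𝒳 ∩ 𝒵) - gf 𝒳 * gf 𝒵) -
      gf (bySize (· ≤ 3 - 1) : Finset (Finset α)) * gf (bySize (3 ≤ ·) : Finset (Finset α)) *
        gf ((𝒳 ∩ 𝒵).filter fun S => #S = 3)).coeff m := by
  set W := (𝒳 ∩ 𝒵).filter fun S => #S = 3 with hWdef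
  have hW3 : ∀ w ∈ W, #w = 3 := fun w hw => (mem_filter.1 hw).2
  have hWsub : ∀ w ∈ W, w ∈ 𝒳 ∧ w ∈ 𝒵 := fun w hw => mem_inter.1 (mem_filter.1 hw).1
  have hDT : Disjoint (dbl m) (lev m 1) := disjoint_dbl_lev_one m
  obtain ⟨d₁, d₂, h12, hDeq⟩ := card_eq_two.1 hD
  have hDeq' : dbl m = {d₂, d₁} := by rw [hDeq, pair_comm]
  have hd₁ : d₁ ∈ dbl m := by rw [hDeq]; simp
  have hd₂ : d₂ ∈ dbl m := by rw [hDeq]; simp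
  have hd₁T : d₁ ∉ lev m 1 := fun h => disjoint_left.1 hDT hd₁ h
  have hd₂T : d₂ ∉ lev m 1 := fun h => disjoint_left.1 hDT hd₂ h
  rw [coeff_sub, sub_nonneg]
  refine (coeff_chargeT_rowTwo_le hm hD (by omega) W hW3).trans (le_trans ?_ (cubes_le_coeff_ee_mul_harris_rowTwo h𝒳 h𝒵 hm hD))
  have hn₁ : d₁ ∉ ({d₂} : Finset α) := by simp [h12]
  have hsumD : ∀ f : α → ℤ, ∑ d ∈ dbl m, f d = f d₁ + f d₂ := fun f => by rw [hDeq, sum_insert hn₁, sum_singleton]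
  have hsumDn : ∀ f : α → ℕ, ∑ d ∈ dbl m, f d = f d₁ + f d₂ := fun f => by rw [hDeq, sum_insert hn₁, sum_singleton]
  -- charge counts against a, q, ε
  have haW : #(((lev m 1).powersetCard 1).filter fun Y => dbl m ∪ Y ∈ W) ≤
      #(((lev m 1).powersetCard 1).filter fun Y => dbl m ∪ Y ∈ 𝒳 ∧ dbl m ∪ Y ∈ 𝒵) :=
    card_le_card fun Y hY => mem_filter.2 ⟨(mem_filter.1 hY).1, hWsub _ (mem_filter.1 hY).2⟩
  have hqW : ∀ d, #(((lev m 1).powersetCard 2).filter fun Q => insert d Q ∈ W) ≤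
      #(((lev m 1).powersetCard 2).filter fun Q => insert d Q ∈ 𝒳 ∧ insert d Q ∈ 𝒵) := fun d =>
    card_le_card fun Q hQ => mem_filter.2 ⟨(mem_filter.1 hQ).1, hWsub _ (mem_filter.1 hQ).2⟩
  have hεW : #(((lev m 1).powersetCard 3).filter fun E => E ∈ W) ≤ #(((lev m 1).powersetCard 3).filter fun E => E ∈ 𝒳 ∧ E ∈ 𝒵) :=
    card_le_card fun E hE => mem_filter.2 ⟨(mem_filter.1 hE).1, hWsub _ (mem_filter.1 hE).2⟩
  -- split the restriction cubes at d₁, d₂ and the link cubes at the other doubled point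
  have hR : ∀ Y ∈ (lev m 1).powersetCard 1,
      kap 𝒳 𝒵 ∅ (lev m 1 \ Y) + kap 𝒳 𝒵 {d₂} (lev m 1 \ Y) + (kap 𝒳 𝒵 {d₁} (lev m 1 \ Y) + kap 𝒳 𝒵 (dbl m) (lev m 1 \ Y)) ≤
        kap 𝒳 𝒵 ∅ (dbl m ∪ (lev m 1 \ Y)) := fun Y hY => by
    have hV1 : d₁ ∉ lev m 1 \ Y := fun h => hd₁T (mem_sdiff.1 h).1
    have hV2 : d₂ ∉ lev m 1 \ Y := fun h => hd₂T (mem_sdiff.1 h).1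
    have e : dbl m ∪ (lev m 1 \ Y) = insert d₁ (insert d₂ (lev m 1 \ Y)) := by rw [hDeq, insert_union, ← insert_eq]
    have s1 := kap_add_kap_le_kap_insert h𝒳 h𝒵 (D := (∅ : Finset α)) (s' := insert d₂ (lev m 1 \ Y)) (notMem_empty d₁)
      (by rw [mem_insert, not_or]; exact ⟨h12, hV1⟩)
    have s2 := kap_add_kap_le_kap_insert h𝒳 h𝒵 (D := (∅ : Finset α)) (s' := lev m 1 \ Y) (notMem_empty d₂) hV2
    have s3 := kap_add_kap_le_kap_insert h𝒳 h𝒵 (D := ({d₁} : Finset α)) (s' := lev m 1 \ Y) (v := d₂)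
      (by rw [mem_singleton]; exact h12.symm) hV2
    rw [insert_empty_eq] at s1 s2
    rw [show insert d₂ ({d₁} : Finset α) = dbl m from by rw [hDeq, pair_comm]] at s3
    rw [e]; linarith
  have hM : ∀ (d d' : α), dbl m = {d, d'} → d ≠ d' → ∀ Q ∈ (lev m 1).powersetCard 2,
      kap 𝒳 𝒵 {d'} (lev m 1 \ Q) + kap 𝒳 𝒵 (dbl m) (lev m 1 \ Q) ≤ kapL1 𝒳 𝒵 m d Q := fun d d' hDe hdd' Q hQ => by
    unfold kapL1
    have hdm : d ∈ dbl m := by rw [hDe]; simp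
    have hdT : d ∉ lev m 1 := fun h => disjoint_left.1 hDT hdm h
    have he : (dbl m).erase d = {d'} := by
      rw [hDe]; ext i; simp only [mem_erase, mem_insert, mem_singleton]
      constructor
      · rintro ⟨hne, h | h⟩
        · exact absurd h hne
        · exact h
      · rintro rfl; exact ⟨hdd'.symm, Or.inr rfl⟩
    have s := kap_add_kap_le_kap_insert h𝒳 h𝒵 (D := ({d'} : Finset α)) (s' := lev m 1 \ Q) (v := d)
      (by rw [mem_singleton]; exact hdd') (fun h => hdT (mem_sdiff.1 h).1)
    rw [show insert d ({d'} : Finset α) = dbl m from by rw [hDe]] at s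
    rw [he]; linarith
  have sRt := sum_le_sum hR
  simp only [sum_add_distrib] at sRt
  have sMa := sum_le_sum (hM d₁ d₂ hDeq h12)
  have sMb := sum_le_sum (hM d₂ d₁ hDeq' h12.symm)
  rw [sum_add_distrib] at sMa sMb
  -- n = τ − 1 and the numeric constants of the charge
  obtain ⟨n, hn⟩ : ∃ n : ℕ, #(lev m 1) = n + 1 := ⟨#(lev m 1) - 1, by omega⟩
  have hn8 : 8 ≤ n := by omega
  have hn6 : 6 ≤ n := by omega
  have ecH3 : 2 * (cH 3 n : ℤ) = (n : ℤ) ^ 2 + n + 2 := two_mul_cH_three (by omega)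
  have eΓ : 2 * (cH 3 (#(lev m 1) + 1) : ℤ) = ((n : ℤ) + 2) ^ 2 + (n + 2) + 2 := by
    rw [hn]; have := two_mul_cH_three (n := n + 2) (by omega); push_cast at this ⊢; linarith
  have ecH2 : (cH 2 (#(lev m 1) - 1) : ℤ) = n + 1 := by
    have hcH2 : cH 2 n = n + 1 := by unfold cH; rw [show min 2 (n + 1 - 2) = 2 from by omega]; simp [sum_range_succ]; omega
    rw [hn, Nat.add_sub_cancel, hcH2]; push_cast; ring
  have ecH1 : (cH 1 (#(lev m 1) - 3) : ℤ) = 1 := by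
    have hcH1 : cH 1 (n - 2) = 1 := by unfold cH; rw [show min 1 (n - 2 + 1 - 1) = 1 from by omega]; simp
    rw [hn, show n + 1 - 3 = n - 2 from by omega, hcH1]; simp
  -- the goal in family form
  rw [hsumD fun d => ∑ Q ∈ (lev m 1).powersetCard 2, kapL1 𝒳 𝒵 m d Q,
    hsumDn fun d => #(((lev m 1).powersetCard 2).filter fun Q => insert d Q ∈ W)]
  push_cast
  rw [ecH2, ecH1, one_mul]
  -- the density facts and the pinned facts in integer form
  obtain ⟨f1, f2, f3⟩ := rowTwo_density_facts_R h𝒳 h𝒵 hX3 hZ3 hD hDeq hn hn6 (𝒳 := 𝒳) (𝒵 := 𝒵)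
  obtain ⟨f4, f5, f6⟩ := rowTwo_density_facts_ML h𝒳 h𝒵 hX3 hZ3 hD hDeq hn hn6 (𝒳 := 𝒳) (𝒵 := 𝒵)
  obtain ⟨hRa, pa3, pa2⟩ := rowTwo_pinned_facts_R h𝒳 h𝒵 hX3 hZ3 hDeq h12 hn hn6 (𝒳 := 𝒳) (𝒵 := 𝒵)
  obtain ⟨hRb, pb3, pb2⟩ := rowTwo_pinned_facts_R h𝒳 h𝒵 hX3 hZ3 hDeq' h12.symm hn hn6 (𝒳 := 𝒳) (𝒵 := 𝒵)
  have ma := rowTwo_pinned_facts_M h𝒳 h𝒵 hX3 hZ3 hDeq h12 hn hn6 (𝒳 := 𝒳) (𝒵 := 𝒵)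
  have mb := rowTwo_pinned_facts_M h𝒳 h𝒵 hX3 hZ3 hDeq' h12.symm hn hn6 (𝒳 := 𝒳) (𝒵 := 𝒵)
  have haW' : (#(((lev m 1).powersetCard 1).filter fun Y => dbl m ∪ Y ∈ W) : ℤ) ≤
      #(((lev m 1).powersetCard 1).filter fun Y => dbl m ∪ Y ∈ 𝒳 ∧ dbl m ∪ Y ∈ 𝒵) := by exact_mod_cast haW
  have hq1W : (#(((lev m 1).powersetCard 2).filter fun Q => insert d₁ Q ∈ W) : ℤ) ≤
      #(((lev m 1).powersetCard 2).filter fun Q => insert d₁ Q ∈ 𝒳 ∧ insert d₁ Q ∈ 𝒵) := by exact_mod_cast hqW d₁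
  have hq2W : (#(((lev m 1).powersetCard 2).filter fun Q => insert d₂ Q ∈ W) : ℤ) ≤
      #(((lev m 1).powersetCard 2).filter fun Q => insert d₂ Q ∈ 𝒳 ∧ insert d₂ Q ∈ 𝒵) := by exact_mod_cast hqW d₂
  have hεW' : (#(((lev m 1).powersetCard 3).filter fun E => E ∈ W) : ℤ) ≤ #(((lev m 1).powersetCard 3).filter fun E => E ∈ 𝒳 ∧ E ∈ 𝒵) := by
    exact_mod_cast hεW
  have hMs : (∑ Q ∈ (lev m 1).powersetCard 2, kap 𝒳 𝒵 {d₂} (lev m 1 \ Q) + ∑ Q ∈ (lev m 1).powersetCard 2, kap 𝒳 𝒵 {d₁} (lev m 1 \ Q))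
      + 2 * ∑ Q ∈ (lev m 1).powersetCard 2, kap 𝒳 𝒵 (dbl m) (lev m 1 \ Q)
      ≤ ∑ Q ∈ (lev m 1).powersetCard 2, kapL1 𝒳 𝒵 m d₁ Q + ∑ Q ∈ (lev m 1).powersetCard 2, kapL1 𝒳 𝒵 m d₂ Q := by
    linarith only [sMa, sMb]
  have hfin := rowTwo_arith (n := (n : ℤ)) (by exact_mod_cast hn8) f1 f2 f3 sRt f4 f5 hMs f6 hRa pa3 pa2 hRb pb3 pb2
    ma mb ecH3 eΓ haW' hq1W hq2W hεW'
  linarith only [hfin]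

end RowTwoAll

end Summit.CriticalPhenomena.PercolationContinuityZ3.Theorems.SahiCTCForms
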